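import Summits.BirchSwinnertonDyer.Rank1Residual.Partition.MainConjecturesEisensteinTwistIdentity
import Literature.NumberTheory.EllipticCurves.Rank1Residual.ClassX1KellerYinCertificate
import Literature.NumberTheory.EllipticCurves.CastellaGrossiLeeSkinner2022.EisensteinRankOnePPartBSD
import Literature.NumberTheory.EllipticCurves.CastellaGrossiSkinner2025.EisensteinPPartBSD
import Literature.NumberTheory.EllipticCurves.SupersingularIrreducibleProofs
import HarnessLib

/-!
# The two `p`-part-of-BSD facts of the Eisenstein class — CGS 2025 Thm. D (A47) and CGLS 2022
# Thm. F (A52) — as THEOREMS granted the MAIN-CONJECTURE-level facts (CGS Thm. A / GV Thm. 1.3),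
# display (5.5), and the published Heegner-point facts

HONEST FRAMING (cell `b2b-bsdres`, run/shared/lean/b2b/bsd-rank1-residual/; verbatim): the goal is to
DELETE the COMBINATION-SHAPED residual classes for ALL analytic-rank `≤ 1` curves over `ℚ` — "full BSD
formula for every rank `≤ 1` curve in class `C`" assembled STRICTLY from published theorems — so
that the rank-`≤ 1` remainder becomes exactly the CONSTRUCTION-SHAPED classes, which are TYPED
(missing-input `Prop`s), NOT attempted; this is not "finishing BSD". NEW WORK of the cell (bookkeeping
over decls already in the tree), hence under `Summits/`; NO definition, NO named fact, nothing about
any particular curve asserted; no label moves (row C6 is COVERED [PUB]). Unit `b2b-bsdres-lit-cgls`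
(off-peak literature typer: Castella–Grossi–Lee–Skinner 2022 / Greenberg–Vatsal 2000), session 4.

## What this file does

The cell's registry carries, for the reducible good-`p` rows, BOTH the headline `p`-part statements
as named facts — A47 `CastellaGrossiSkinner2025.thmD_padicValRat_bsd_rank_le_one` (CGS 2025 Thm. D,
`r ∈ {0,1}`) and A52 `CastellaGrossiLeeSkinner2022.thmF_padicValRat_bsd_rank_one` (CGLS 2022 Thm. F,
`r = 1`) — AND the main-conjecture-level statements they are printed consequences of: CGS Thm. A
(`…thmA_charIdeal_eq_padicLFunction`, Mazur's MC), GV 2000 Thm. 1.3 (`…thm13_charIdeal_eq_of_gvPar`),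
display (5.5) (`…display55_sha_heegnerIndex`, the anticyclotomic package BDP-IMC + control + BDP
formula read at the trivial character). Sessions 2–4 re-assembled the printed proofs of Thm. D and
Thm. F in the kernel down to Miller's `BSD(E,p)`; this file closes the loop to the LITERAL fact
statements, so that the referee may carry A47 and A52 (and A149, `display57_of_display55`) as DERIVED
rows:

* `RowC6.printShape_of_bsdp_of_not_anom` — `BSD(E,p)` ⇒ the no-torsion print shape
  `L^{(r)}(E,1)/(r!·Ω·Reg) = q`, `ord_p q = ord_p #Ш + ord_p ∏c_ℓ` at a good non-anomalous `p > 2`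
  (`pPart_of_bsdp` + `p ∤ #E(ℚ)_tors`, `not_dvd_torsionOrder_of_not_anom`).
* `RowC6.cgsThmD_of_display55_of_cgsThmA : … → thmD_padicValRat_bsd_rank_le_one` — **A47 from
  A142 (Thm. A) + A157 ((5.5)) + Greenberg Thm. 4.1, modularity, Hoffstein–Luo, Gross–Zagier (both
  currencies), Kolyvagin, GZK** (`RowC6.bsdp_of_display55_of_cgsThmA`, session 4).
* `RowC6.cglsThmF_of_display55_of_gvThm13 : … → thmF_padicValRat_bsd_rank_one` — **A52 from GV
  Thm. 1.3 + A157 + the same published facts** (`RowC6.bsdp_rankOne_of_display55_of_gvThm13`), with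
  NO Castella–Grossi–Skinner 2025 input (outside the `CGS25-BST-Thm311` documentation flag).

Nothing is discharged unconditionally (every input is a named fact `def … : Prop` of the tree, fed as
a binder); what is gained is that the registry's Eisenstein good-`p` column rests on the typed MAIN
CONJECTURES + one display, not on three further paper-level statements.

References: [CastellaGrossiSkinner2025] Thm. A, Thm. D and its proof (§0.3 p. 5);
[CastellaGrossiLeeSkinner2022] Thm. F = Thm. 5.3.1 and its proof (5.4)–(5.7), Thm. 5.1.4;
[GreenbergVatsal2000] Thm. (1.3); [GreenbergLNM1716] Thm. 4.1; [GrossZagier1986] I.(6.5), I.(7.3), V.§2;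
[Gross1991] Thm. 1.3; [HoffsteinLuo1997]; [Miller2011LMS] Def. 1.1. Deliverable:
HOME/b2b-bsdres-lit-cgls/CGLS-GV-TYPING.md §11 (session 4).
-/

set_option autoImplicit false

noncomputable section

open scoped Classical MatrixGroups ModularForm

open CongruenceSubgroup WeierstrassCurve NumberField Literature.NumberTheory.EllipticCurves
  Literature.NumberTheory.EllipticCurves.ModularForms Literature.NumberTheory.QuadraticFields
  Literature.NumberTheory.EllipticCurves.Rank1Residual
  Literature.NumberTheory.EllipticCurves.Rank1Residual.Typed
  Literature.NumberTheory.EllipticCurves.CastellaGrossiLeeSkinner2022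

namespace Summit.BirchSwinnertonDyer.Rank1Residual

/-- **`BSD(E,p)` ⇒ the no-torsion print shape at a good non-anomalous `p > 2`.** For `W/ℚ` globally
minimal elliptic with `ord_{s=1}L(E,s) ≤ 1`: Miller's `BSD(E,p)` gives the cell's general print shape
`PPart W p` (`pPart_of_bsdp`: `L^{(r)}(E,1)/(r!·Ω·Reg) = q ∈ ℚ` with
`ord_p q = ord_p #Ш + ord_p ∏c_ℓ − 2·ord_p #E(ℚ)_tors`), and `p ∤ #E(ℚ)_tors` at a good `p > 2` with
`a_p ≢ 1 (mod p)` (`not_dvd_torsionOrder_of_not_anom`) kills the torsion term — the shape in which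
CGS Thm. D / CGLS Thm. F are printed (`E(ℚ)[p] = 0` there). [cite: Miller2011LMS, §1 and Def. 1.1 (arXiv:1010.2431 p. 3)]
[cite: CastellaGrossiSkinner2025, Thm. D (display)] -/
theorem RowC6.printShape_of_bsdp_of_not_anom (hmod : hasEntireLFunction_rat)
    (hGZK : rank_eq_analyticRank_of_analyticRank_le_one)
    (W : WeierstrassCurve ℚ) [W.IsElliptic] [W.IsGloballyMinimal] (p : ℕ) [Fact p.Prime]
    (hp : 2 < p) (hgood : Good W p) (hna : ¬ Anom W p) (hr : W.analyticRank ≤ 1) (hB : BSDp W p) :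
    ∃ q : ℚ, W.leadingLCoeff / ((W.realPeriodRat * W.regulator : ℝ) : ℂ) = (q : ℂ) ∧
      padicValRat p q = (padicValNat p W.shaOrder : ℤ) + padicValNat p W.tamagawaProduct := by
  obtain ⟨q, hq, hv⟩ := pPart_of_bsdp hmod hGZK W p hr hB
  have ht : padicValNat p W.torsionOrder = 0 :=
    padicValNat.eq_zero_of_not_dvd (not_dvd_torsionOrder_of_not_anom W p hp hgood hna)
  refine ⟨q, hq, ?_⟩
  rw [hv, ht]
  push_cast
  ring

/-- **A47 derived: Castella–Grossi–Skinner 2025 Thm. D (`r ∈ {0,1}`), in its LITERAL typed form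
`thmD_padicValRat_bsd_rank_le_one`, from Theorem A (`hA`, A142), display (5.5) (`h55`, A157) and the
published facts** Greenberg Thm. 4.1 (`hGr`), modularity (`hmodP`, `hnf`), Hoffstein–Luo (`hHL`),
Gross–Zagier over `ℚ` (`hGZQ`, Thm. I.7.3) and over `K` (`hGZ`), Kolyvagin (`hKo`), GZK (`hGZK`):
the printed proof ("`r = 0`: as [CGLS22, Thm. 5.1.4] with Theorem A in place of [GV00]; `r = 1`: as
in [CGLS22, Thm. 5.3.1] … applying the rank-`0` case to `E^K`") is `RowC6.bsdp_of_display55_of_cgsThmA`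
(session 4), and the literal display is `RowC6.printShape_of_bsdp_of_not_anom`. The fact's own
`Finite Ш` binder is not needed (GZK). [cite: CastellaGrossiSkinner2025, Thm. D (= "Thm. 4") and its proof (§0.3 p. 5), Theorem A]
[cite: CastellaGrossiLeeSkinner2022, proof of Thm. 5.3.1 (5.4)–(5.7), Thm. 5.1.4] -/
theorem RowC6.cgsThmD_of_display55_of_cgsThmA (h55 : display55_sha_heegnerIndex)
    (hA : CastellaGrossiSkinner2025.thmA_charIdeal_eq_padicLFunction)
    (hGr : greenberg_charValue_rankZero) (hmodP : nonempty_modularParametrizationData)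
    (hnf : exists_isNewformOf) (hHL : HoffsteinLuo1997_exists_twist_L_one_ne_zero)
    (hGZQ : GrossZagier1986_thm_I_7_3)
    (hGZ : ∀ (N : ℕ) [NeZero N] (W : WeierstrassCurve ℚ) (K : Type) [Field K] [NumberField K],
      gross_zagier N W K)
    (hKo : ∀ (N : ℕ) [NeZero N] (W : WeierstrassCurve ℚ) (K : Type) [Field K] [NumberField K],
      kolyvagin N W K)
    (hGZK : rank_eq_analyticRank_of_analyticRank_le_one) :
    CastellaGrossiSkinner2025.thmD_padicValRat_bsd_rank_le_one := by
  intro W _ _ p _ hp hgood hred hna hr _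
  have hmod : hasEntireLFunction_rat := WeierstrassCurve.hasEntireLFunction_rat_of_exists_isNewformOf hnf
  exact RowC6.printShape_of_bsdp_of_not_anom hmod hGZK W p hp hgood hna hr
    (RowC6.bsdp_of_display55_of_cgsThmA h55 hA hGr hmodP hnf hHL hGZQ hGZ hKo hGZK W p hp hgood hred hna
      hr)

/-- **A52 derived: Castella–Grossi–Lee–Skinner 2022 Thm. F (= Thm. 5.3.1), in its LITERAL typed form
`thmF_padicValRat_bsd_rank_one`, from Greenberg–Vatsal 2000 Thm. 1.3 (`hGV`), display (5.5) (`h55`,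
A157) and the published facts** Greenberg Thm. 4.1, modularity, Hoffstein–Luo, Gross–Zagier (both
currencies), Kolyvagin, GZK — the printed proof end to end (`RowC6.bsdp_rankOne_of_display55_of_gvThm13`,
session 4: (5.5) ⇒ (5.7), GV on the partner), then the literal display
(`RowC6.printShape_of_bsdp_of_not_anom`). "good ordinary" gives `Good`; the rational line of the
second bullet makes `E[p]` reducible (`red_of_isRationalLine`); the fact's `Finite Ш` binder is not
needed. NO Castella–Grossi–Skinner 2025 input. [cite: CastellaGrossiLeeSkinner2022, Theorem F = Thm. 5.3.1 and its proof ((5.4)–(5.7), last paragraph)]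
[cite: GreenbergVatsal2000, Thm. (1.3)] [cite: GreenbergLNM1716, Thm. 4.1 (p. 102)] -/
theorem RowC6.cglsThmF_of_display55_of_gvThm13 (h55 : display55_sha_heegnerIndex)
    (hGV : GreenbergVatsal2000.thm13_charIdeal_eq_of_gvPar) (hGr : greenberg_charValue_rankZero)
    (hmodP : nonempty_modularParametrizationData) (hnf : exists_isNewformOf)
    (hHL : HoffsteinLuo1997_exists_twist_L_one_ne_zero) (hGZQ : GrossZagier1986_thm_I_7_3)
    (hGZ : ∀ (N : ℕ) [NeZero N] (W : WeierstrassCurve ℚ) (K : Type) [Field K] [NumberField K],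
      gross_zagier N W K)
    (hKo : ∀ (N : ℕ) [NeZero N] (W : WeierstrassCurve ℚ) (K : Type) [Field K] [NumberField K],
      kolyvagin N W K)
    (hGZK : rank_eq_analyticRank_of_analyticRank_le_one) :
    CastellaGrossiLeeSkinner2022.thmF_padicValRat_bsd_rank_one := by
  intro W _ _ p _ hp hord hco hna hr _
  have hmod : hasEntireLFunction_rat := WeierstrassCurve.hasEntireLFunction_rat_of_exists_isNewformOf hnf
  obtain ⟨Φ, hΦ, hco'⟩ := hco
  have hred : Red W p := red_of_isRationalLine hΦ
  exact RowC6.printShape_of_bsdp_of_not_anom hmod hGZK W p hp hord.1 hna (le_of_eq hr)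
    (RowC6.bsdp_rankOne_of_display55_of_gvThm13 h55 hGV hGr hmodP hnf hHL hGZQ hGZ hKo hGZK W p hp hord.1
      hred hna ⟨Φ, hΦ, hco'⟩ hr)

end Summit.BirchSwinnertonDyer.Rank1Residual

end
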